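import Summits.AnomalousDissipation.AnomalousDissipation.Theorems.SolenoidalFractalHomogenisationLagrangianStepCellChainDefsFrame
import Summits.AnomalousDissipation.AnomalousDissipation.Theorems.SolenoidalFractalHomogenisationLagrangianStepCellChainModes
import Summits.AnomalousDissipation.AnomalousDissipation.Theorems.SolenoidalFractalHomogenisationLagrangianStepCellChainLinksFrame
import HarnessLib

/-!
# K1L_D `LagrangianRenormalisationStepDesign` (stmt-AnomalousDissipation-27980), registered stub `stub_D1_V0θg` (v28, ruling D28-3 (3)), port-map layer L2:
# the MODES of a weak solution of the FROZEN-FRAME tensor cell problem as absolutely continuous functions of time with the TWISTED CHAIN ODE as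
# a.e. derivative (helper; `--kind proof --supports stmt-AnomalousDissipation-27980 --as helper`)

Summits-side helper file of route `SolenoidalFractalHomogenisation` (prover seat `ad-k1l-cellLawV-w1` g9; port map
`Cruxes/LagrangianRenormalisationStepDesign/Lines/onelevel-vtheta-twist-portmap.md` §3 L2).  Everything proved; no definitions (those are
`…CellChainDefsFrame`: `modeRHSθ`, `modeRepθ`), no named facts, no sorry.  VERBATIM port of `…CellChainModes` under the dictionary
`transversalProj k ↦ transversalProjR (twistFreq G₀ k)`, `kdot k ↦ rdot (twistFreq G₀ k)`, `symbT 𝔹 ↦ symbT (Visc4.conj G₀ 𝔹)`,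
`IsWeakTensorPassiveVectorOn ↦ IsWeakTensorPassiveVectorDistortedOn … (fun _ _ => G₀)`.
Setting: `h : Torus.IsWeakTensorPassiveVectorDistortedOn 0 T 𝔹 (W₁.cell n) (fun _ _ => G₀) F u`, `F ∈ L¹`; `û(t) = 𝓕(complexify ∘ u t)`; `q := twistFreq G₀ k = G₀ᵀk`.

* §1 algebra of the twisted chain right-hand side: `rdot_modeRHSθ` (it is transversal to `G₀ᵀk`), `inner_modeRHSθ_eq` (its pairing with a transversal `z` is the
  scalar integrand of `…CellChainLinksFrame.ae_inner_mFourierCoeff_eq_cell_frame`);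
* §2 `integrableOn_modeRHSθ`: `modeRHSθ … k ∈ L¹(0,T)`;
* §3 THE REPRESENTATIVE: `continuousOn_modeRepθ`, `rdot_modeRepθ`, **`ae_eq_modeRepθ`** (`û(t)(k) = modeRepθ … k t` for a.e. `t ∈ (0,T)`), `ae_forall_eq_modeRepθ`,
  **`ae_hasDerivAt_modeRepθ`**, `ae_restrict_hasDerivAt_modeRepθ`, `modeRHSθ_eq_of_forall_eq`, `ae_hasDerivAt_modeRepθ_rep` (the closed countable ODE system a.e.);
* §4 `sum_sq_norm_mFourierCoeff_le_frame` (finite Bessel, a.e. in time) and **`absolutelyContinuousOnInterval_modeRepθ`** (AC on every `[a,b] ⊆ [0,T]`).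
NOT a proof of `stub_D1_V0θg`, of K1L_D, or of anomalous dissipation; rung F-D1.A0 infrastructure.
-/

set_option linter.dupNamespace false

noncomputable section

namespace Summit.AnomalousDissipation.AnomalousDissipation.Theorems.SolenoidalFractalHomogenisation.LagrangianStep.CellChain

open Set MeasureTheory Filter Topology Function Complex UnitAddTorus
open scoped InnerProductSpace ComplexConjugate
open Literature.Analysis Literature.Analysis.FunctionSpaces Literature.Analysis.FunctionSpaces.Torus
open Literature.Analysis.FluidPDE Literature.Analysis.FluidPDE.Torus Literature.Analysis.FluidPDE.LatticeShear
open Summit.AnomalousDissipation.AnomalousDissipation.Theorems.SolenoidalFractalHomogenisation.RealisedQuasiStaticCellLaw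
open Summit.AnomalousDissipation.AnomalousDissipation.Theorems.SolenoidalFractalHomogenisation.PermissibleCarrier

variable {k₀ : ℕ}

/-! ## §1 Algebra of the twisted chain right-hand side -/

/-- `P_q` maps into the transversal subspace, for every real `q` (for `q = 0` trivially). [cite: Temam1984, Ch. III §1.1] -/
theorem rdot_transversalProjR' (q : Fin 3 → ℝ) (z : EuclideanSpace ℂ (Fin 3)) : rdot q (transversalProjR q z) = 0 := by
  by_cases hq : q = 0
  · subst hq
    rw [rdot_apply]
    simp
  · exact rdot_transversalProjR hq z

/-- The twisted transversality in the `vecMul` form of `…DistortedConstFrameFourier` / `…CellChainLinksFrame`. [cite: ArmstrongVicol2025, §4.1 (PDF p. 34)] -/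
theorem sum_vecMul_mul_eq_rdot (G₀ : Matrix (Fin 3) (Fin 3) ℝ) (k : Fin 3 → ℤ) (z : EuclideanSpace ℂ (Fin 3)) :
    ∑ b, ((Matrix.vecMul (fun a => (k a : ℝ)) G₀ b : ℝ) : ℂ) * z b = rdot (twistFreq G₀ k) z := (rdot_twistFreq G₀ k z).symm

/-- **The twisted chain right-hand side is transversal to the twisted frequency**: `(G₀ᵀk) · modeRHSθ … k τ = 0`. [cite: Temam1984, Ch. III §1.1] -/
theorem rdot_modeRHSθ (W₁ : LatticeWord k₀) (n : ℕ) (𝔹 : Torus.Visc4 (Fin 3)) (G₀ : Matrix (Fin 3) (Fin 3) ℝ)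
    (u : ℝ → UnitAddTorus (Fin 3) → EuclideanSpace ℝ (Fin 3)) (k : Fin 3 → ℤ) (τ : ℝ) :
    rdot (twistFreq G₀ k) (modeRHSθ W₁ n 𝔹 G₀ u k τ) = 0 := by
  rw [modeRHSθ_def, map_sub, map_neg, map_smul, rdot_transversalProjR', smul_zero, neg_zero, map_sum]
  simp only [map_smul, rdot_transversalProjR', smul_zero, Finset.sum_const_zero, sub_zero]

/-- **Pairing of the twisted chain right-hand side with a transversal vector** is the scalar integrand of the twisted chain identity
`CellChainLinksFrame.ae_inner_mFourierCoeff_eq_cell_frame`: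
`⟪modeRHSθ … k τ, z⟫ = −4π² ⟪û(τ)(k), T_{𝔹^{G₀}}(k) z⟫ + Σⱼ linkCoeffⱼ(k,τ)·(a′ⱼ ⟪û(τ)(k − Kⱼ), z⟫ + aⱼ ⟪û(τ)(k + Kⱼ), z⟫)` (`(G₀ᵀk) · z = 0`).
[cite: MeshalkinSinai1961, pp. 1700–1705] [cite: ArmstrongVicol2025, §4.1 (PDF p. 34)] -/
theorem inner_modeRHSθ_eq (W₁ : LatticeWord k₀) (n : ℕ) (𝔹 : Torus.Visc4 (Fin 3)) (G₀ : Matrix (Fin 3) (Fin 3) ℝ)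
    (u : ℝ → UnitAddTorus (Fin 3) → EuclideanSpace ℝ (Fin 3))
    (k : Fin 3 → ℤ) (τ : ℝ) {z : EuclideanSpace ℂ (Fin 3)} (hz : rdot (twistFreq G₀ k) z = 0) :
    ⟪modeRHSθ W₁ n 𝔹 G₀ u k τ, z⟫_ℂ =
      (-(4 * Real.pi ^ 2 : ℝ) : ℂ) * ⟪mFourierCoeff (EuclideanSpace.complexify ∘ u τ) k, Torus.symbT (Torus.Visc4.conj G₀ 𝔹) k z⟫_ℂ +
        ∑ j, linkCoeff W₁ n k j τ *
          ((starRingEnd ℂ (Complex.exp ((W₁.phase j).φ * Complex.I)) *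
                (-(1 / (2 * ((2 * Real.pi * ‖latticeVec (W₁.phase j).m‖ : ℝ) : ℂ) * Complex.I)))) *
              ⟪mFourierCoeff (EuclideanSpace.complexify ∘ u τ) (k - fun i => (W₁.phase j).m i * n), z⟫_ℂ +
            (Complex.exp ((W₁.phase j).φ * Complex.I) * (1 / (2 * ((2 * Real.pi * ‖latticeVec (W₁.phase j).m‖ : ℝ) : ℂ) * Complex.I))) *
              ⟪mFourierCoeff (EuclideanSpace.complexify ∘ u τ) (k + fun i => (W₁.phase j).m i * n), z⟫_ℂ) := by
  rw [modeRHSθ_def, inner_sub_left, inner_neg_left, inner_smul_left, inner_transversalProjR_left_of_rdot_eq_zero _ hz,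
    inner_symbT_majorTranspose_left, sum_inner, Complex.conj_ofReal]
  have hj : ∀ j : Fin k₀,
      ⟪linkCoeff W₁ n k j τ • transversalProjR (twistFreq G₀ k)
          ((Complex.exp ((W₁.phase j).φ * Complex.I) * (1 / (2 * ((2 * Real.pi * ‖latticeVec (W₁.phase j).m‖ : ℝ) : ℂ) * Complex.I))) •
              mFourierCoeff (EuclideanSpace.complexify ∘ u τ) (k - fun i => (W₁.phase j).m i * n) +
            (starRingEnd ℂ (Complex.exp ((W₁.phase j).φ * Complex.I)) *
                (-(1 / (2 * ((2 * Real.pi * ‖latticeVec (W₁.phase j).m‖ : ℝ) : ℂ) * Complex.I)))) •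
              mFourierCoeff (EuclideanSpace.complexify ∘ u τ) (k + fun i => (W₁.phase j).m i * n)), z⟫_ℂ =
        -(linkCoeff W₁ n k j τ *
          ((starRingEnd ℂ (Complex.exp ((W₁.phase j).φ * Complex.I)) *
                (-(1 / (2 * ((2 * Real.pi * ‖latticeVec (W₁.phase j).m‖ : ℝ) : ℂ) * Complex.I)))) *
              ⟪mFourierCoeff (EuclideanSpace.complexify ∘ u τ) (k - fun i => (W₁.phase j).m i * n), z⟫_ℂ +
            (Complex.exp ((W₁.phase j).φ * Complex.I) * (1 / (2 * ((2 * Real.pi * ‖latticeVec (W₁.phase j).m‖ : ℝ) : ℂ) * Complex.I))) *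
              ⟪mFourierCoeff (EuclideanSpace.complexify ∘ u τ) (k + fun i => (W₁.phase j).m i * n), z⟫_ℂ)) := by
    intro j
    rw [inner_smul_left, conj_linkCoeff, inner_transversalProjR_left_of_rdot_eq_zero _ hz, inner_add_left, inner_smul_left,
      inner_smul_left, layerAmp_conj, layerAmp'_conj]
    ring
  simp only [hj, Finset.sum_neg_distrib, sub_neg_eq_add]
  ring

/-! ## §2 Integrability of the twisted chain right-hand side on `(0,T)` -/

/-- **The twisted chain right-hand side of a weak solution is integrable on `(0,T)`.** [cite: DiPernaLions1989, §II.1 (12)–(14)] -/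
theorem integrableOn_modeRHSθ (W₁ : LatticeWord k₀) (n : ℕ) {T : ℝ} {𝔹 : Torus.Visc4 (Fin 3)} {G₀ : Matrix (Fin 3) (Fin 3) ℝ}
    {F : UnitAddTorus (Fin 3) → EuclideanSpace ℝ (Fin 3)} {u : ℝ → UnitAddTorus (Fin 3) → EuclideanSpace ℝ (Fin 3)}
    (h : Torus.IsWeakTensorPassiveVectorDistortedOn 0 T 𝔹 (W₁.cell n) (fun _ _ => G₀) F u) (k : Fin 3 → ℤ) :
    IntegrableOn (modeRHSθ W₁ n 𝔹 G₀ u k) (Ioo 0 T) volume := by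
  have hm : ∀ k', Integrable (fun τ => mFourierCoeff (EuclideanSpace.complexify ∘ u τ) k') (volume.restrict (Ioo 0 T)) :=
    fun k' => h.integrableOn_mFourierCoeff k'
  -- the viscous part: a continuous linear image of the mode
  have hvisc : Integrable (fun τ => -(((4 * Real.pi ^ 2 : ℝ) : ℂ) • transversalProjR (twistFreq G₀ k)
      (Torus.symbT (Torus.majorTranspose (Torus.Visc4.conj G₀ 𝔹)) k (mFourierCoeff (EuclideanSpace.complexify ∘ u τ) k))))
      (volume.restrict (Ioo 0 T)) := by
    have h1 := ((transversalProjR (twistFreq G₀ k)).comp (symbTL (Torus.majorTranspose (Torus.Visc4.conj G₀ 𝔹)) k)).integrable_comp (hm k)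
    exact (h1.smul (((4 * Real.pi ^ 2 : ℝ) : ℂ))).neg
  -- the link part: bounded continuous scalar times a continuous linear image of the neighbouring modes
  have hlink : ∀ j : Fin k₀, Integrable (fun τ => linkCoeff W₁ n k j τ • transversalProjR (twistFreq G₀ k)
      ((Complex.exp ((W₁.phase j).φ * Complex.I) * (1 / (2 * ((2 * Real.pi * ‖latticeVec (W₁.phase j).m‖ : ℝ) : ℂ) * Complex.I))) •
          mFourierCoeff (EuclideanSpace.complexify ∘ u τ) (k - fun i => (W₁.phase j).m i * n) +
        (starRingEnd ℂ (Complex.exp ((W₁.phase j).φ * Complex.I)) *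
            (-(1 / (2 * ((2 * Real.pi * ‖latticeVec (W₁.phase j).m‖ : ℝ) : ℂ) * Complex.I)))) •
          mFourierCoeff (EuclideanSpace.complexify ∘ u τ) (k + fun i => (W₁.phase j).m i * n))) (volume.restrict (Ioo 0 T)) := by
    intro j
    have hA : Integrable (fun τ =>
        (Complex.exp ((W₁.phase j).φ * Complex.I) * (1 / (2 * ((2 * Real.pi * ‖latticeVec (W₁.phase j).m‖ : ℝ) : ℂ) * Complex.I))) •
          mFourierCoeff (EuclideanSpace.complexify ∘ u τ) (k - fun i => (W₁.phase j).m i * n)) (volume.restrict (Ioo 0 T)) :=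
      (hm (k - fun i => (W₁.phase j).m i * n)).smul
        (Complex.exp ((W₁.phase j).φ * Complex.I) * (1 / (2 * ((2 * Real.pi * ‖latticeVec (W₁.phase j).m‖ : ℝ) : ℂ) * Complex.I)))
    have hB : Integrable (fun τ =>
        (starRingEnd ℂ (Complex.exp ((W₁.phase j).φ * Complex.I)) *
            (-(1 / (2 * ((2 * Real.pi * ‖latticeVec (W₁.phase j).m‖ : ℝ) : ℂ) * Complex.I)))) •
          mFourierCoeff (EuclideanSpace.complexify ∘ u τ) (k + fun i => (W₁.phase j).m i * n)) (volume.restrict (Ioo 0 T)) :=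
      (hm (k + fun i => (W₁.phase j).m i * n)).smul
        (starRingEnd ℂ (Complex.exp ((W₁.phase j).φ * Complex.I)) *
            (-(1 / (2 * ((2 * Real.pi * ‖latticeVec (W₁.phase j).m‖ : ℝ) : ℂ) * Complex.I))))
    have h1 := (transversalProjR (twistFreq G₀ k)).integrable_comp (hA.add hB)
    have h2 := h1.bdd_smul (2 * Real.pi * ‖∑ a, ((W₁.phase j).e a : ℂ) * (k a)‖ * (1 / (n : ℝ)))
      (continuous_linkCoeff W₁ n k j).aestronglyMeasurable (Eventually.of_forall fun τ => norm_linkCoeff_le W₁ n k j τ)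
    exact h2
  have hsum := integrable_finsetSum Finset.univ fun j (_ : j ∈ Finset.univ) => hlink j
  have e : modeRHSθ W₁ n 𝔹 G₀ u k = fun τ => -(((4 * Real.pi ^ 2 : ℝ) : ℂ) • transversalProjR (twistFreq G₀ k)
      (Torus.symbT (Torus.majorTranspose (Torus.Visc4.conj G₀ 𝔹)) k (mFourierCoeff (EuclideanSpace.complexify ∘ u τ) k))) -
      ∑ j, linkCoeff W₁ n k j τ • transversalProjR (twistFreq G₀ k)
        ((Complex.exp ((W₁.phase j).φ * Complex.I) * (1 / (2 * ((2 * Real.pi * ‖latticeVec (W₁.phase j).m‖ : ℝ) : ℂ) * Complex.I))) •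
            mFourierCoeff (EuclideanSpace.complexify ∘ u τ) (k - fun i => (W₁.phase j).m i * n) +
          (starRingEnd ℂ (Complex.exp ((W₁.phase j).φ * Complex.I)) *
              (-(1 / (2 * ((2 * Real.pi * ‖latticeVec (W₁.phase j).m‖ : ℝ) : ℂ) * Complex.I)))) •
            mFourierCoeff (EuclideanSpace.complexify ∘ u τ) (k + fun i => (W₁.phase j).m i * n)) := by
    funext τ; rw [modeRHSθ_def]
  rw [IntegrableOn, e]
  exact hvisc.sub (by simpa only [Finset.sum_apply] using hsum)

/-- The twisted chain right-hand side is interval-integrable on `[0,T]`. [cite: DiPernaLions1989, §II.1 (12)–(14)] -/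
theorem intervalIntegrable_modeRHSθ (W₁ : LatticeWord k₀) (n : ℕ) {T : ℝ} (hT : 0 ≤ T) {𝔹 : Torus.Visc4 (Fin 3)} {G₀ : Matrix (Fin 3) (Fin 3) ℝ}
    {F : UnitAddTorus (Fin 3) → EuclideanSpace ℝ (Fin 3)} {u : ℝ → UnitAddTorus (Fin 3) → EuclideanSpace ℝ (Fin 3)}
    (h : Torus.IsWeakTensorPassiveVectorDistortedOn 0 T 𝔹 (W₁.cell n) (fun _ _ => G₀) F u) (k : Fin 3 → ℤ) :
    IntervalIntegrable (modeRHSθ W₁ n 𝔹 G₀ u k) volume 0 T :=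
  (intervalIntegrable_iff_integrableOn_Ioo_of_le hT).2 (integrableOn_modeRHSθ W₁ n h k)

/-! ## §3 The continuous representative of a mode -/

/-- **The representative is continuous on `[0,T]`** (primitive of an integrable function). [cite: Temam1984, Ch. III §1.1] -/
theorem continuousOn_modeRepθ (W₁ : LatticeWord k₀) (n : ℕ) {T : ℝ} (hT : 0 ≤ T) {𝔹 : Torus.Visc4 (Fin 3)} {G₀ : Matrix (Fin 3) (Fin 3) ℝ}
    {F : UnitAddTorus (Fin 3) → EuclideanSpace ℝ (Fin 3)} {u : ℝ → UnitAddTorus (Fin 3) → EuclideanSpace ℝ (Fin 3)}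
    (h : Torus.IsWeakTensorPassiveVectorDistortedOn 0 T 𝔹 (W₁.cell n) (fun _ _ => G₀) F u) (k : Fin 3 → ℤ) :
    ContinuousOn (modeRepθ W₁ n 𝔹 G₀ F u k) (Icc 0 T) := by
  have hi : IntegrableOn (modeRHSθ W₁ n 𝔹 G₀ u k) (uIcc 0 T) volume := by
    rw [uIcc_of_le hT, integrableOn_Icc_iff_integrableOn_Ioo]
    exact integrableOn_modeRHSθ W₁ n h k
  have hc := intervalIntegral.continuousOn_primitive_interval (μ := volume) hi
  rw [uIcc_of_le hT] at hc
  exact continuousOn_const.add hc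

/-- **The representative is transversal to the twisted frequency**: `(G₀ᵀk) · modeRepθ … k t = 0` for `t ∈ [0,T]`. [cite: Temam1984, Ch. III §1.1] -/
theorem rdot_modeRepθ (W₁ : LatticeWord k₀) (n : ℕ) {T : ℝ} (hT : 0 ≤ T) {𝔹 : Torus.Visc4 (Fin 3)} {G₀ : Matrix (Fin 3) (Fin 3) ℝ}
    {F : UnitAddTorus (Fin 3) → EuclideanSpace ℝ (Fin 3)} {u : ℝ → UnitAddTorus (Fin 3) → EuclideanSpace ℝ (Fin 3)}
    (h : Torus.IsWeakTensorPassiveVectorDistortedOn 0 T 𝔹 (W₁.cell n) (fun _ _ => G₀) F u) (k : Fin 3 → ℤ) {t : ℝ} (ht : t ∈ Icc 0 T) :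
    rdot (twistFreq G₀ k) (modeRepθ W₁ n 𝔹 G₀ F u k t) = 0 := by
  rw [modeRepθ_def, map_add, rdot_transversalProjR', zero_add]
  have hi : IntervalIntegrable (modeRHSθ W₁ n 𝔹 G₀ u k) volume 0 t :=
    (intervalIntegrable_modeRHSθ W₁ n hT h k).mono_set (by
      rw [uIcc_of_le hT, uIcc_of_le ht.1]; exact Icc_subset_Icc_right ht.2)
  have hc := (LinearMap.toContinuousLinearMap (rdot (twistFreq G₀ k))).intervalIntegral_comp_comm hi
  simp only [LinearMap.coe_toContinuousLinearMap', rdot_modeRHSθ, intervalIntegral.integral_zero] at hc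
  exact hc.symm

/-- **THE TWISTED VECTOR CHAIN IDENTITY**: the a.e.-defined mode `t ↦ û(t)(k)` of a weak solution of the frozen-frame tensor cell problem coincides a.e. on
`(0,T)` with its continuous representative `modeRepθ … k` (`= P^θ_k F̂(k) + ∫₀ᵗ modeRHSθ`).  Proof: both are transversal to `G₀ᵀk`, and their pairings with
the three transversal vectors `P^θ_k eᵢ` agree a.e. by the scalar twisted chain identity + `inner_modeRHSθ_eq`.
[cite: Temam1984, Ch. III §1.1] [cite: ArmstrongVicol2025, §4.1 (PDF p. 34)] -/
theorem ae_eq_modeRepθ (W₁ : LatticeWord k₀) (n : ℕ) {T : ℝ} (hT : 0 ≤ T) {𝔹 : Torus.Visc4 (Fin 3)} {G₀ : Matrix (Fin 3) (Fin 3) ℝ}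
    {F : UnitAddTorus (Fin 3) → EuclideanSpace ℝ (Fin 3)} {u : ℝ → UnitAddTorus (Fin 3) → EuclideanSpace ℝ (Fin 3)}
    (h : Torus.IsWeakTensorPassiveVectorDistortedOn 0 T 𝔹 (W₁.cell n) (fun _ _ => G₀) F u) (hF : Integrable F volume) (k : Fin 3 → ℤ) :
    ∀ᵐ t ∂(volume.restrict (Ioo 0 T)), mFourierCoeff (EuclideanSpace.complexify ∘ u t) k = modeRepθ W₁ n 𝔹 G₀ F u k t := by
  -- the scalar identities against the transversal vectors `P^θ_k eᵢ`
  have hsc : ∀ i : Fin 3, ∀ᵐ t ∂(volume.restrict (Ioo 0 T)),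
      ⟪mFourierCoeff (EuclideanSpace.complexify ∘ u t) k, transversalProjR (twistFreq G₀ k) (EuclideanSpace.single i (1:ℂ))⟫_ℂ =
        ⟪modeRepθ W₁ n 𝔹 G₀ F u k t, transversalProjR (twistFreq G₀ k) (EuclideanSpace.single i (1:ℂ))⟫_ℂ := by
    intro i
    have hz : rdot (twistFreq G₀ k) (transversalProjR (twistFreq G₀ k) (EuclideanSpace.single i (1:ℂ))) = 0 := rdot_transversalProjR' _ _
    have hz' : ∑ b, ((Matrix.vecMul (fun a => (k a : ℝ)) G₀ b : ℝ) : ℂ) *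
        (transversalProjR (twistFreq G₀ k) (EuclideanSpace.single i (1:ℂ))) b = 0 := by
      rw [sum_vecMul_mul_eq_rdot]; exact hz
    have h1 := ae_inner_mFourierCoeff_eq_cell_frame W₁ n h hF k hz'
    filter_upwards [h1, ae_restrict_mem measurableSet_Ioo] with t ht htT
    rw [ht, modeRepθ_def, inner_add_left, inner_transversalProjR_left_of_rdot_eq_zero _ hz,
      intervalIntegral.integral_of_le htT.1.le]
    congr 1
    have hi : Integrable (modeRHSθ W₁ n 𝔹 G₀ u k) (volume.restrict (Ioc 0 t)) :=
      (integrableOn_modeRHSθ W₁ n h k).mono_set (Ioc_subset_Ioo_right htT.2)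
    rw [← inner_conj_symm, ← integral_inner hi, ← integral_conj]
    refine (setIntegral_congr_fun measurableSet_Ioc fun τ _ => ?_).symm
    rw [inner_conj_symm, inner_modeRHSθ_eq W₁ n 𝔹 G₀ u k τ hz]
    simp only [linkCoeff_def]
  have hsc' : ∀ᵐ t ∂(volume.restrict (Ioo 0 T)), ∀ i : Fin 3,
      ⟪mFourierCoeff (EuclideanSpace.complexify ∘ u t) k, transversalProjR (twistFreq G₀ k) (EuclideanSpace.single i (1:ℂ))⟫_ℂ =
        ⟪modeRepθ W₁ n 𝔹 G₀ F u k t, transversalProjR (twistFreq G₀ k) (EuclideanSpace.single i (1:ℂ))⟫_ℂ := ae_all_iff.2 hsc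
  filter_upwards [hsc', h.ae_sum_vecMul_mul_mFourierCoeff_eq_zero, ae_restrict_mem measurableSet_Ioo] with t hall hkt htT
  set D : EuclideanSpace ℂ (Fin 3) := mFourierCoeff (EuclideanSpace.complexify ∘ u t) k - modeRepθ W₁ n 𝔹 G₀ F u k t with hD_def
  have hD : rdot (twistFreq G₀ k) D = 0 := by
    rw [hD_def, map_sub, ← sum_vecMul_mul_eq_rdot, hkt k, rdot_modeRepθ W₁ n hT h k ⟨htT.1.le, htT.2.le⟩, sub_zero]
  have hDi : ∀ i : Fin 3, ⟪D, EuclideanSpace.single i (1:ℂ)⟫_ℂ = 0 := by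
    intro i
    have hP : ⟪D, transversalProjR (twistFreq G₀ k) (EuclideanSpace.single i (1:ℂ))⟫_ℂ = 0 := by
      rw [hD_def, inner_sub_left, sub_eq_zero]
      exact hall i
    have hrest : ⟪D, EuclideanSpace.single i (1:ℂ) - transversalProjR (twistFreq G₀ k) (EuclideanSpace.single i (1:ℂ))⟫_ℂ = 0 := by
      rw [transversalProjR_apply, sub_sub_cancel, inner_smul_right, ← inner_conj_symm, inner_waveVecRC_left, hD, map_zero, mul_zero]
    calc ⟪D, EuclideanSpace.single i (1:ℂ)⟫_ℂ
        = ⟪D, transversalProjR (twistFreq G₀ k) (EuclideanSpace.single i (1:ℂ))⟫_ℂ +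
            ⟪D, EuclideanSpace.single i (1:ℂ) - transversalProjR (twistFreq G₀ k) (EuclideanSpace.single i (1:ℂ))⟫_ℂ := by
          rw [← inner_add_right, add_sub_cancel]
      _ = 0 := by rw [hP, hrest, add_zero]
  have hD0 : D = 0 := by
    ext i
    have hi := hDi i
    rw [EuclideanSpace.inner_single_right, one_mul] at hi
    simpa using hi
  exact sub_eq_zero.1 hD0

/-- All modes at once: for a.e. `t ∈ (0,T)`, `û(t)(k) = modeRepθ … k t` for EVERY `k`. [cite: Temam1984, Ch. III §1.1] -/
theorem ae_forall_eq_modeRepθ (W₁ : LatticeWord k₀) (n : ℕ) {T : ℝ} (hT : 0 ≤ T) {𝔹 : Torus.Visc4 (Fin 3)} {G₀ : Matrix (Fin 3) (Fin 3) ℝ}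
    {F : UnitAddTorus (Fin 3) → EuclideanSpace ℝ (Fin 3)} {u : ℝ → UnitAddTorus (Fin 3) → EuclideanSpace ℝ (Fin 3)}
    (h : Torus.IsWeakTensorPassiveVectorDistortedOn 0 T 𝔹 (W₁.cell n) (fun _ _ => G₀) F u) (hF : Integrable F volume) :
    ∀ᵐ t ∂(volume.restrict (Ioo 0 T)), ∀ k, mFourierCoeff (EuclideanSpace.complexify ∘ u t) k = modeRepθ W₁ n 𝔹 G₀ F u k t :=
  ae_all_iff.2 fun k => ae_eq_modeRepθ W₁ n hT h hF k

/-- **THE TWISTED CHAIN ODE AS AN a.e. DERIVATIVE**: for a.e. `t ∈ (0,T)`, `HasDerivAt (modeRepθ … k) (modeRHSθ … k t) t`. [cite: Temam1984, Ch. III §1.1] -/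
theorem ae_hasDerivAt_modeRepθ (W₁ : LatticeWord k₀) (n : ℕ) {T : ℝ} (hT : 0 ≤ T) {𝔹 : Torus.Visc4 (Fin 3)} {G₀ : Matrix (Fin 3) (Fin 3) ℝ}
    {F : UnitAddTorus (Fin 3) → EuclideanSpace ℝ (Fin 3)} {u : ℝ → UnitAddTorus (Fin 3) → EuclideanSpace ℝ (Fin 3)}
    (h : Torus.IsWeakTensorPassiveVectorDistortedOn 0 T 𝔹 (W₁.cell n) (fun _ _ => G₀) F u) (k : Fin 3 → ℤ) :
    ∀ᵐ t ∂(volume : Measure ℝ), t ∈ Ioo 0 T → HasDerivAt (modeRepθ W₁ n 𝔹 G₀ F u k) (modeRHSθ W₁ n 𝔹 G₀ u k t) t := by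
  have hL := (intervalIntegrable_modeRHSθ W₁ n hT h k).ae_hasDerivAt_integral
  filter_upwards [hL] with t ht htI
  have h0 : (0:ℝ) ∈ uIcc 0 T := by rw [uIcc_of_le hT]; exact ⟨le_rfl, hT⟩
  have ht' : t ∈ uIcc 0 T := by rw [uIcc_of_le hT]; exact ⟨htI.1.le, htI.2.le⟩
  exact (ht ht' 0 h0).const_add _

/-- The same in the `volume.restrict (Ioo 0 T)` form. [cite: Temam1984, Ch. III §1.1] -/
theorem ae_restrict_hasDerivAt_modeRepθ (W₁ : LatticeWord k₀) (n : ℕ) {T : ℝ} (hT : 0 ≤ T) {𝔹 : Torus.Visc4 (Fin 3)} {G₀ : Matrix (Fin 3) (Fin 3) ℝ}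
    {F : UnitAddTorus (Fin 3) → EuclideanSpace ℝ (Fin 3)} {u : ℝ → UnitAddTorus (Fin 3) → EuclideanSpace ℝ (Fin 3)}
    (h : Torus.IsWeakTensorPassiveVectorDistortedOn 0 T 𝔹 (W₁.cell n) (fun _ _ => G₀) F u) (k : Fin 3 → ℤ) :
    ∀ᵐ t ∂(volume.restrict (Ioo 0 T)), HasDerivAt (modeRepθ W₁ n 𝔹 G₀ F u k) (modeRHSθ W₁ n 𝔹 G₀ u k t) t :=
  (ae_restrict_iff' measurableSet_Ioo).2 (ae_hasDerivAt_modeRepθ W₁ n hT h k)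

/-- The twisted chain right-hand side read on the representatives (a pointwise rewriting, valid wherever all modes agree with their representatives).
[cite: MeshalkinSinai1961, pp. 1700–1705] -/
theorem modeRHSθ_eq_of_forall_eq (W₁ : LatticeWord k₀) (n : ℕ) (𝔹 : Torus.Visc4 (Fin 3)) (G₀ : Matrix (Fin 3) (Fin 3) ℝ)
    (F : UnitAddTorus (Fin 3) → EuclideanSpace ℝ (Fin 3)) (u : ℝ → UnitAddTorus (Fin 3) → EuclideanSpace ℝ (Fin 3)) {t : ℝ}
    (hrep : ∀ k, mFourierCoeff (EuclideanSpace.complexify ∘ u t) k = modeRepθ W₁ n 𝔹 G₀ F u k t) (k : Fin 3 → ℤ) :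
    modeRHSθ W₁ n 𝔹 G₀ u k t =
      -(((4 * Real.pi ^ 2 : ℝ) : ℂ) • transversalProjR (twistFreq G₀ k)
          (Torus.symbT (Torus.majorTranspose (Torus.Visc4.conj G₀ 𝔹)) k (modeRepθ W₁ n 𝔹 G₀ F u k t))) -
        ∑ j, linkCoeff W₁ n k j t • transversalProjR (twistFreq G₀ k)
          ((Complex.exp ((W₁.phase j).φ * Complex.I) * (1 / (2 * ((2 * Real.pi * ‖latticeVec (W₁.phase j).m‖ : ℝ) : ℂ) * Complex.I))) •
              modeRepθ W₁ n 𝔹 G₀ F u (k - fun i => (W₁.phase j).m i * n) t +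
            (starRingEnd ℂ (Complex.exp ((W₁.phase j).φ * Complex.I)) *
                (-(1 / (2 * ((2 * Real.pi * ‖latticeVec (W₁.phase j).m‖ : ℝ) : ℂ) * Complex.I)))) •
              modeRepθ W₁ n 𝔹 G₀ F u (k + fun i => (W₁.phase j).m i * n) t) := by
  simp only [modeRHSθ_def, hrep]

/-- **The closed countable twisted ODE system, a.e.**: for a.e. `t ∈ (0,T)`, every representative is differentiable at `t` with derivative the twisted chain
right-hand side READ ON THE REPRESENTATIVES. [cite: MeshalkinSinai1961, pp. 1700–1705] [cite: Temam1984, Ch. III §1.1] -/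
theorem ae_hasDerivAt_modeRepθ_rep (W₁ : LatticeWord k₀) (n : ℕ) {T : ℝ} (hT : 0 ≤ T) {𝔹 : Torus.Visc4 (Fin 3)} {G₀ : Matrix (Fin 3) (Fin 3) ℝ}
    {F : UnitAddTorus (Fin 3) → EuclideanSpace ℝ (Fin 3)} {u : ℝ → UnitAddTorus (Fin 3) → EuclideanSpace ℝ (Fin 3)}
    (h : Torus.IsWeakTensorPassiveVectorDistortedOn 0 T 𝔹 (W₁.cell n) (fun _ _ => G₀) F u) (hF : Integrable F volume) :
    ∀ᵐ t ∂(volume.restrict (Ioo 0 T)), ∀ k, HasDerivAt (modeRepθ W₁ n 𝔹 G₀ F u k)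
      (-(((4 * Real.pi ^ 2 : ℝ) : ℂ) • transversalProjR (twistFreq G₀ k)
          (Torus.symbT (Torus.majorTranspose (Torus.Visc4.conj G₀ 𝔹)) k (modeRepθ W₁ n 𝔹 G₀ F u k t))) -
        ∑ j, linkCoeff W₁ n k j t • transversalProjR (twistFreq G₀ k)
          ((Complex.exp ((W₁.phase j).φ * Complex.I) * (1 / (2 * ((2 * Real.pi * ‖latticeVec (W₁.phase j).m‖ : ℝ) : ℂ) * Complex.I))) •
              modeRepθ W₁ n 𝔹 G₀ F u (k - fun i => (W₁.phase j).m i * n) t +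
            (starRingEnd ℂ (Complex.exp ((W₁.phase j).φ * Complex.I)) *
                (-(1 / (2 * ((2 * Real.pi * ‖latticeVec (W₁.phase j).m‖ : ℝ) : ℂ) * Complex.I)))) •
              modeRepθ W₁ n 𝔹 G₀ F u (k + fun i => (W₁.phase j).m i * n) t)) t := by
  have hd : ∀ᵐ t ∂(volume.restrict (Ioo 0 T)), ∀ k, HasDerivAt (modeRepθ W₁ n 𝔹 G₀ F u k) (modeRHSθ W₁ n 𝔹 G₀ u k t) t :=
    ae_all_iff.2 fun k => ae_restrict_hasDerivAt_modeRepθ W₁ n hT h k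
  filter_upwards [hd, ae_forall_eq_modeRepθ W₁ n hT h hF] with t hdt hrep k
  rw [← modeRHSθ_eq_of_forall_eq W₁ n 𝔹 G₀ F u hrep k]
  exact hdt k

/-! ## §4 Finite Bessel and absolute continuity -/

/-- **Finite Bessel, a.e. in time** (frozen-frame class): `Σ_{k∈S} ‖û(t)(k)‖² ≤ ∫‖u t‖²` for every finite `S` and a.e. `t ∈ (0,T)`.
[cite: Grafakos2014, Prop. 3.2.7 (3)] -/
theorem sum_sq_norm_mFourierCoeff_le_frame (W₁ : LatticeWord k₀) (n : ℕ) {T : ℝ} {𝔹 : Torus.Visc4 (Fin 3)} {G₀ : Matrix (Fin 3) (Fin 3) ℝ}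
    {F : UnitAddTorus (Fin 3) → EuclideanSpace ℝ (Fin 3)} {u : ℝ → UnitAddTorus (Fin 3) → EuclideanSpace ℝ (Fin 3)}
    (h : Torus.IsWeakTensorPassiveVectorDistortedOn 0 T 𝔹 (W₁.cell n) (fun _ _ => G₀) F u) (S : Finset (Fin 3 → ℤ)) :
    ∀ᵐ t ∂(volume.restrict (Ioo 0 T)), ∑ k ∈ S, ‖mFourierCoeff (EuclideanSpace.complexify ∘ u t) k‖ ^ 2 ≤ ∫ x, ‖u t x‖ ^ 2 := by
  filter_upwards [h.ae_memLp_two] with t ht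
  exact sum_le_hasSum S (fun k _ => sq_nonneg _) (hasSum_sq_norm_mFourierCoeff_complexify ht)

/-- **The representative is absolutely continuous on every `[a,b] ⊆ [0,T]`** (frozen frame). [cite: Temam1984, Ch. III §1.1] -/
theorem absolutelyContinuousOnInterval_modeRepθ (W₁ : LatticeWord k₀) (n : ℕ) {T : ℝ} (hT : 0 ≤ T) {𝔹 : Torus.Visc4 (Fin 3)}
    {G₀ : Matrix (Fin 3) (Fin 3) ℝ}
    {F : UnitAddTorus (Fin 3) → EuclideanSpace ℝ (Fin 3)} {u : ℝ → UnitAddTorus (Fin 3) → EuclideanSpace ℝ (Fin 3)}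
    (h : Torus.IsWeakTensorPassiveVectorDistortedOn 0 T 𝔹 (W₁.cell n) (fun _ _ => G₀) F u) (k : Fin 3 → ℤ) {a b : ℝ}
    (ha : a ∈ Icc 0 T) (hb : b ∈ Icc 0 T) :
    AbsolutelyContinuousOnInterval (modeRepθ W₁ n 𝔹 G₀ F u k) a b := by
  have hi := intervalIntegrable_modeRHSθ W₁ n hT h k
  have h0 : (0:ℝ) ∈ uIcc 0 T := by rw [uIcc_of_le hT]; exact ⟨le_rfl, hT⟩
  have ha' : a ∈ uIcc 0 T := by rw [uIcc_of_le hT]; exact ha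
  have hb' : b ∈ uIcc 0 T := by rw [uIcc_of_le hT]; exact hb
  have hsub : uIcc a b ⊆ uIcc 0 T := uIcc_subset_uIcc ha' hb'
  have hG : AbsolutelyContinuousOnInterval (fun x => ∫ τ in (0:ℝ)..x, ‖modeRHSθ W₁ n 𝔹 G₀ u k τ‖) a b :=
    (hi.norm.absolutelyContinuousOnInterval_intervalIntegral h0).mono hsub
  refine absolutelyContinuousOnInterval_of_dist_le hG fun x hx y hy => ?_
  have hx' : x ∈ uIcc 0 T := hsub hx
  have hy' : y ∈ uIcc 0 T := hsub hy
  have hix : IntervalIntegrable (modeRHSθ W₁ n 𝔹 G₀ u k) volume 0 x := hi.mono_set (uIcc_subset_uIcc h0 hx')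
  have hiy : IntervalIntegrable (modeRHSθ W₁ n 𝔹 G₀ u k) volume 0 y := hi.mono_set (uIcc_subset_uIcc h0 hy')
  rw [modeRepθ_def, modeRepθ_def, dist_add_left, dist_eq_norm, Real.dist_eq,
    intervalIntegral.integral_interval_sub_left hix hiy, intervalIntegral.integral_interval_sub_left hix.norm hiy.norm]
  exact intervalIntegral.norm_integral_le_abs_integral_norm

end Summit.AnomalousDissipation.AnomalousDissipation.Theorems.SolenoidalFractalHomogenisation.LagrangianStep.CellChain

end
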